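import Summits.BirchSwinnertonDyer.Rank1Residual.JET.CarrierReadingRecordsKitThree
import HarnessLib

/-!
# BSD rank-≤1 residual cell, lane class X4 (ADDITIVE at `3`, `ρ̄_{E,3}` onto), BOTH ranks, Tamagawa-OBSTRUCTED with ONE carrier prime `q ≠ 3`:
# `BSD(E,3)` PER CELL through the JET lane's R-IDX kit doors `JET.bsdp_of_jetRowA3F_tam_min` / `_tamX_min` (ANY reduction at `3`, `3`-adic
# tower by ONE Frobenius witness mod `9`; READING binder K1) on a two-engine HEEGNER-INDEX line in a DEEP field — records 03 (x11c GEN 36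
# «J1-REMAINDER / KOLY-R»)

HONEST FRAMING (cell `b2b-bsdres-*`, verbatim): prove what is provable now; shrink each hard class to its core with data; no claim beyond
stated classes; COMBINATION classes deleted from PUBLISHED theorems only, CONSTRUCTION-shaped remainder typed; this is not "finishing BSD".
X4 / X11b (and X11 ∧ r = 1 ∧ p = 3) stay CONSTRUCTION-SHAPED; everything here is PER CELL; no lane verdict is changed; NO named fact is
introduced (debt 0) and NO definition; nothing is booked by this file (bookings are referee A's, pub-bsdpct); Cremona's numbers (`r_an`,
`#Ш_an`, models, generators, `∏ c_ℓ`, torsion, optimality / Manin codes, the galrep datum) and the Kurihara lane's per-prime tables are INPUTS.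

Unit `b2b-bsdres-x11c`, GEN 36 (prover-b2b-bsdres-x11c-g36-0), move «J1-REMAINDER / KOLY-R». POPULATION (`HOME/b2b-bsdres-x11c/gen36/pop/`:
`census36.py` over referee A's ROUND 983 state of record × the Kurihara lane's sweep records × Cremona, then `build_pop36.py`): EVERY live
residue cell on the Kolyvagin / Jetchev road classes (X4, X7, X8, X11a, X11b), BOTH ranks, odd `p`, whose shape is KOLY (`ρ̄_{E,p}` onto,
`p ∤ #E(ℚ)_tors·∏c·#Ш_an`: 30 cells) or J1 (onto, `p ∤ #E(ℚ)_tors·#Ш_an`, exactly ONE prime `q ∣ N` with `p ∣ c_q`: 171 cells; the two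
J1 cells whose carrier is an ADDITIVE `p` have no door and are excluded) — 199 cells on 191 classes (188 of them with this cell as their ONLY
open cell): 82 rank-one `(3, X11b)`, 59 `(5, X4)` + 2 `(7, X4)` (rank one 19 / rank zero 42), 26 `(3, X4)` J1 (1 / 25), 20 `(3, X4)` KOLY
(6 / 14), 10 KOLY at `p ≥ 5`. The lane never certified them: at rank one its Heegner fields (`|D| ≤ 1511`) read `ord_p [E(K):ℤy_K] = w + 1`
or found no admissible field; at rank zero (additive `p`) no Heegner-index line was ever run. THIS UNIT ran the cell's engines VERBATIM in
DEEPER fields: engine 1 = gen 3 `engine1_cha1b/main.py` = x9-g7 `jobD1b.py` (cypari2, sha256 `69e29ec7…`; rank-one mode: Cremona's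
generator, `hy = L'(E,1)·L(E^D,1)·√|D|/(4·Area)`, `m = √(4·hy/ĥ(P))`; rank-zero mode: the rank-one twist `F = E^D`, a point `x ∈ F(ℚ)` by
`ellrank`, saturated, `hy = L(E,1)·L'(F,1)·√|D|/(4·Area)`, `m = √(4·hy/ĥ(x))` — Miller 2011 Thm. 4.1 / Cor. 4.8; `NDISC 16`, `DBOUND 6000`);
engine 2 = gen 3 `run_cert.py` (`1b54bb20…`) + `e2lib.py` + `tate_stdlib.py` (stdlib re-implementation: `m`, `ord_p m` must be EQUAL,
discrete checks); twist values = additive-p1 `twistvals/main.py` (`e501b988…`). Kit jobs: see HOME/b2b-bsdres-x11c/gen36/harvest/JOBS-gen36.txt. Evidence `HOME/b2b-bsdres-x11c/gen36/`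
(POP36.md, ROWS36-TABLE.md, harvest outputs with inputs.sha256, SHA256SUMS); REPORT.md §45.

THE ROAD (cell `bsd-jet`'s R-IDX grammar, the doors referee A priced at pub-bsdpct ROUNDS 409 / 516 / 600 and booked this unit's
JDEEP rows on at ROUND 890): Jetchev 2008 Thm. 1.4 / Cor. 1.5 READ at the ONE Tamagawa carrier — READING binder K1
`JET.JetchevDivisibilityCarrierNe` (p459625; carrier `q ≠ p`) or K3 `JET.JetchevDivisibilityCarrierMult` (p463660; carrier `q = p` split
multiplicative), both `@[conjecture]` typed readings CONSUMED AS HYPOTHESES (nothing about K1 / K3 is asserted here) — + McCallum 1991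
Cor. 5.6 (`hMcU`), GZK (`hGZK`), Kolyvagin / Gross–Zagier bookkeeping (`hKo`, `hrec`, `hD36`, `hlev`): with `w = ord_p c_q` at the carrier
and a Heegner field `K` in which `ord_p [E(K):ℤy_K] ≤ w`, `Ш(E/ℚ)[p] = 0`, and with `ord_p #Ш_an = 0`, Miller's `BSD(E,p)`.
IN THE KERNEL per cell (`decide` / `norm_num` goals of ONE kit application): the literal Cremona model (`Δ ≠ 0`; global minimality by the
factored Kraus criterion `Supersingular.isGloballyMinimal_of_krausCriterion₃_factored` on the COMPLETE factorisation of `|Δ|`); `ρ̄_{E,p}`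
ONTO (Serre 1972: three Prop-19 witnesses at `p ≥ 5` / an irreducible Frobenius + a Frobenius of order `3` at `p = 3`; the `p`-adic tower
inside the door: Serre IV-23 at `p ≥ 5`, the Tate line at a multiplicative `3`, ONE Frobenius witness mod `9` otherwise); at a
multiplicative `3`: `3 ∣ Δ`, `3 ∤ c₄`; the carrier's Tamagawa number from ONE `TamLocal` (split `I_n`) or exact `TamX` (`IV` / `IV*`)
certificate (n1011-p03's bridges `Additive.IntModelTam.localTamagawaNumber_padic_eq_of_intModel_of_tamLocal` / `_of_tamX`) and
`w ≤ ord_p c_q`. DISPLAYED (hypotheses of every record): `hJ` (READING), `hMcU`, `hGZK`, `hKo`, `hrec`, `hD36`, `hlev`; the Heegner datum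
(`K` imaginary quadratic, `d_K ∉ {−3, −4}`, Heegner hypothesis for the level `N`, `P` a Heegner point of infinite order), bucket A: `q ∣ N`;
the INDEX LINE `hv : ord_p [E(K):ℤP] ≤ w` — THIS UNIT's two-engine deep-field datum, quoted per docstring, NOT re-computed here —;
`hr : r_an ≤ 1`; `hs` / `hvs` : `#Ш_an` a `p`-adic unit (Cremona; exact at rank 0).
What a record is worth is the referee's call (EVIDENCE-grade certificate under displayed binders, as every Heegner-index record of the
cell). Cells in this file: `474318e1`@3, `475722bc1`@3, `480474c1`@3, `483318o1`@3, `483426l1`@3, `487026z1`@3, `488070dt1`@3.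

References: D. Jetchev, Compos. Math. 144 (2008) Thm. 1.4, Cor. 1.5 [Jetchev2008]; W. McCallum, LMS LN 153 (1991) §1, Cor. 5.6
[McCallumLMS1991]; B. H. Gross, LMS LN 153 (1991) Prop. 2.1 [GrossLMS1991]; V. A. Kolyvagin (1990) [KolyvaginEulerSystems1990];
J.-P. Serre, Invent. Math. 15 (1972) §2.4 Prop. 15, §2.8 Prop. 19 [Serre1972]; J.-P. Serre, *Abelian ℓ-adic representations* IV-23
[SerreAbelianLadic1968]; B. H. Gross, D. Zagier, Invent. Math. 84 (1986) [GrossZagier1986]; R. L. Miller, LMS J. Comput. Math. 14 (2011)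
Thm. 4.1, Cor. 4.8, Def. 1.1 [Miller2011LMS]; C. Wuthrich, Doc. Math. 19 (2014) Lemma 20 [Wuthrich2014]; J. H. Silverman, *AEC* (2009)
VII.1, VII.5 [SilvermanAEC2009], *ATAEC* (1994) IV.9.4 [SilvermanATAEC1994]; A. Kraus, Acta Arith. 54 (1989) [Kraus1989]; Cremona's
tables [Cremona2006].
-/

set_option autoImplicit false

noncomputable section

open scoped Classical

open WeierstrassCurve Literature.NumberTheory.EllipticCurves
  Literature.NumberTheory.EllipticCurves.ModularForms
  Literature.NumberTheory.EllipticCurves.Rank1Residual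
  Literature.NumberTheory.EllipticCurves.Rank1Residual.Typed
  Literature.NumberTheory.EllipticCurves.Rank1Residual.X11RankOneCertificates
  Summit.BirchSwinnertonDyer.BirchSwinnertonDyer.Rank1Residual
  Summit.BirchSwinnertonDyer.BirchSwinnertonDyer.Rank1Residual.IntModel
  Summit.BirchSwinnertonDyer.BirchSwinnertonDyer.Rank1Residual.X11RankOne
  Summit.BirchSwinnertonDyer.BirchSwinnertonDyer.Rank2Observatory.Tam
  Summit.BirchSwinnertonDyer.Rank1Residual.JET

namespace Summit.BirchSwinnertonDyer.Rank1Residual.X4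

/-- **`BSD(E,3)` for `474318e1`** (cell `(474318e1, 3)`, class X4, rank 0; JET grammar key `JETA:474318e1@3`, bucket A at `p = 3`, `E` additive at
`3` (door `JET.bsdp_of_jetRowA3F_tam_min`, `3`-adic tower by a Frobenius witness mod `9`)); `N = 474318 = 2·3^2·13·2027`, additive `III` at `3`,
`r_an = 0`, `#E(ℚ)_tors = 2`, `∏c = 144`, `#Ш_an = 1`, Cremona galrep: no code at this prime (`ρ̄_{E,3}` onto); `|Δ| = ∏` over `[(2, 36), (3, 3),
(13, 4), (2027, 1)]` (factored Kraus criterion, every disjunct decided). The ONE carrier: carrier `q = 2` (split `I36`, `c_q = 36`, `w = ord_3 c_q =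
2`; IN THE KERNEL by the `TamLocal` certificate `⟨2, 1, 1, 0, 0, 0, 0, 36, 0, 0, 36⟩`); READING binder `hJ` = K1 `JetchevDivisibilityCarrierNe`;
displayed index line `hv : ord_3 [E(K):ℤP] ≤ 2`. Serre Prop-15 witnesses mod `3`: `(ℓ, #Ẽ(𝔽_ℓ))` = `(5, 8)` (`X² − aX + ℓ` root-free over `𝔽₃`),
`(67, 78)` (`ℓ ≡ 1`, `a ≡ 2 (mod 3)`, `9 ∤ #Ẽ`); `3`-adic tower witness `(ℓ₉, #Ẽ) = (29, 24)` (`ℓ₉ ≡ 2 (mod 9)`, `a_ℓ₉ ≡ 6 (mod 9)`). Kurihara lane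
note of record: «additive p, irreducible». State of record (referee A ROUND 983, `scratchA_A_state_after_x4gh_add3_onA2R977_fold.pkl`): class
`residue`, 1 open cell(s), register empty. FLAG `opt-code-2` (Cremona optimality code 2; `ρ̄_{E,3}` onto forbids a `3`-isogeny in the class, so
`ord_3` of the index is class-invariant; the reading stands if the optimal curve's Manin constant is prime to `3`). Other engine-1 fields tried
(`D`: `m` (`ord_3 m`)): `-95`: `m = 288` (`ord = 2`); `-191`: `m = 144` (`ord = 2`); `-263`: `m = 144` (`ord = 2`); `-287`: `m = 144` (`ord = 2`);
`-623`: `m = 144` (`ord = 2`); `-647`: `m = 144` (`ord = 2`); `-959`: `m = 144` (`ord = 2`); `-1343`: `m = 144` (`ord = 2`); `-1439`: `m = 144`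
(`ord = 2`); `-1535`: `m = 288` (`ord = 2`); `-1559`: `m = 144` (`ord = 2`); `-1655`: `m = 576` (`ord = 2`). THIS UNIT'S DATUM (displayed, NOT
re-computed here): DEEP FIELD `K = ℚ(√-23)` (`23` = prime): rank-one twist `F = E^D` (`N_F = 250914222`), point `x` on `F` by ellrank0 (saturated at
the primes `< 100`), **`m = [E(K):ℤy_K] = 144`, `ord_3 m = 2`** (`ρ = m²/4`, `L(E,1) = 3.8763132644`, `L'(F,1) = 25.974456494`, `ĥ(x) =
4.5922401925`) — engine 1 j293245 = engine 2 j293855: `m = 144` EQUAL (FAIL:p2_not_div_N, dev ≤ 5.3e-15); twist `E^D` (j293857): `N = 250914222`,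
`#tors·∏c·#Ш_an = 2·576·1`, `ord_3 #Ш_an(E^D) = 0`, `ord_3 ∏c(E^D) = 2` (BSD-consistent). CONDITIONAL on every binder; per cell; nothing booked by
this file.
[cite: Jetchev2008, Thm. 1.4 and Cor. 1.5 (p. 812)] [cite: McCallumLMS1991, Cor. 5.6] [cite: Serre1972, §2.4 Prop. 15, §2.8 Prop. 19] [cite: Cremona2006, Table 1 (label 474318e1)] -/
theorem bsdpJD_474318e1_3
    (hJ : JetchevDivisibilityCarrierNe)
    (hMcU : McCallum1991_padicValNat_card_sha_primary_add_le_of_globalDivisibility)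
    (hGZK : rank_eq_analyticRank_of_analyticRank_le_one)
    (hKo : ∀ (N : ℕ) [NeZero N] (W : WeierstrassCurve ℚ) (K : Type) [Field K] [NumberField K], kolyvagin N W K)
    (hrec : ∀ (N : ℕ) [NeZero N] (W : WeierstrassCurve ℚ) (K : Type) [Field K] [NumberField K],
      heegnerPointOfConductor_one_galoisConj N W K)
    (hD36 : ∀ (N : ℕ) [NeZero N] (W : WeierstrassCurve ℚ) (K : Type) [Field K] [NumberField K],
      phi_heegnerTau_mem_singularModuliField N W K)
    (hlev : ∀ {N : ℕ} [NeZero N], IsNewformOf.level_eq_conductorNorm (N := N))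
    (W : WeierstrassCurve ℚ) (hW : W = ⟨1, -1, 1, -3880466, -2898677999⟩)
    {N : ℕ} [NeZero N] {K : Type} [Field K] [NumberField K] (hK : IsImaginaryQuadratic K)
    (hD3 : NumberField.discr K ≠ -3) (hD4 : NumberField.discr K ≠ -4)
    (hH : SatisfiesHeegnerHypothesis N K) {P : (W.baseChange K).toAffine.Point}
    (hP : IsHeegnerPoint N W K P) (hnt : ¬ IsOfFinAddOrder P) (hqN : 2 ∣ N)
    (hv : padicValNat 3 (AddSubgroup.zmultiples P).index ≤ 2)
    (hr : W.analyticRank ≤ 1) {s : ℚ} (hs : shaAn W = (s : ℂ)) (hvs : padicValRat 3 s = 0) : BSDp W 3 :=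
  bsdp_of_jetRowA3F_tam_min 1 (-1) 1 (-3880466) (-2898677999)
    (Supersingular.isGloballyMinimal_of_krausCriterion₃_factored 1 (-1) 1 (-3880466) (-2898677999) [(2, 36), (3, 3), (13, 4), (2027, 1)] (by decide +kernel)
      (by intro t ht; fin_cases ht <;> norm_num) (by decide +kernel))
    5 67 (by norm_num) (by norm_num) (by decide) (by decide) (by decide) (by decide) (by decide +kernel) (by decide +kernel)
    (n₁ := 8) (n₂ := 78) (by decide +kernel) (by decide +kernel) (by decide) (by decide) (by decide) (by decide)
    29 (by norm_num) (by decide) (by decide +kernel) (n₉ := 24) (by decide +kernel) (by decide) (by decide)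
    2 ⟨2, 1, 1, 0, 0, 0, 0, 36, 0, 0, 36⟩ rfl (by decide +kernel) (c := 36) (by decide +kernel) (w := 2) (by decide +kernel) (by decide)
    hJ hMcU hGZK hKo hrec hD36 hlev W hW hK hD3 hD4 hH hP hnt hqN hv hr hs hvs

/-- **`BSD(E,3)` for `475722bc1`** (cell `(475722bc1, 3)`, class X4, rank 0; JET grammar key `JETA:475722bc1@3`, bucket A at `p = 3`, `E` additive
at `3` (door `JET.bsdp_of_jetRowA3F_tam_min`, `3`-adic tower by a Frobenius witness mod `9`)); `N = 475722 = 2·3^2·13·19·107`, additive `I0*` at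
`3`, `r_an = 0`, `#E(ℚ)_tors = 1`, `∏c = 54`, `#Ш_an = 1`, Cremona galrep: no code at this prime (`ρ̄_{E,3}` onto); `|Δ| = ∏` over `[(2, 27), (3,
6), (13, 1), (19, 1), (107, 1)]` (factored Kraus criterion, every disjunct decided). The ONE carrier: carrier `q = 2` (split `I27`, `c_q = 27`, `w =
ord_3 c_q = 3`; IN THE KERNEL by the `TamLocal` certificate `⟨2, 1, 1, 0, 0, 0, 0, 27, 0, 0, 27⟩`); READING binder `hJ` = K1
`JetchevDivisibilityCarrierNe`; displayed index line `hv : ord_3 [E(K):ℤP] ≤ 3`. Serre Prop-15 witnesses mod `3`: `(ℓ, #Ẽ(𝔽_ℓ))` = `(11, 14)` (`X² −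
aX + ℓ` root-free over `𝔽₃`), `(7, 6)` (`ℓ ≡ 1`, `a ≡ 2 (mod 3)`, `9 ∤ #Ẽ`); `3`-adic tower witness `(ℓ₉, #Ẽ) = (83, 72)` (`ℓ₉ ≡ 2 (mod 9)`, `a_ℓ₉ ≡
3 (mod 9)`). Kurihara lane note of record: «additive p, irreducible». State of record (referee A ROUND 983,
`scratchA_A_state_after_x4gh_add3_onA2R977_fold.pkl`): class `residue`, 1 open cell(s), register empty. Other engine-1 fields tried (`D`: `m`
(`ord_3 m`)): `-623`: `m = 108` (`ord = 3`); `-887`: `m = 108` (`ord = 3`); `-911`: `m = 108` (`ord = 3`); `-1199`: `m = 108` (`ord = 3`); `-1247`: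
`m = 108` (`ord = 3`); `-2207`: `m = 108` (`ord = 3`); `-2279`: `m = 108` (`ord = 3`); `-4031`: `m = 108` (`ord = 3`); `-4055`: `m = 108` (`ord =
3`); `-4247`: `m = 108` (`ord = 3`); `-4559`: `m = 108` (`ord = 3`). THIS UNIT'S DATUM (displayed, NOT re-computed here): DEEP FIELD `K = ℚ(√-287)`
(`287` = 7·41): rank-one twist `F = E^D` (`N_F = 39184745418`), point `x` on `F` by ellrank0 (saturated at the primes `< 100`), **`m = [E(K):ℤy_K] =
108`, `ord_3 m = 3`** (`ρ = m²/4`, `L(E,1) = 5.4326964763`, `L'(F,1) = 16.779368131`, `ĥ(x) = 5.8190931993`) — engine 1 j293243 = engine 2 j293855: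
`m = 108` EQUAL (FAIL:p2_not_div_N, dev ≤ 1.3e-14); twist `E^D` (j293857): `N = 39184745418`, `#tors·∏c·#Ш_an = 1·108·1`, `ord_3 #Ш_an(E^D) = 0`,
`ord_3 ∏c(E^D) = 3` (BSD-consistent). CONDITIONAL on every binder; per cell; nothing booked by this file.
[cite: Jetchev2008, Thm. 1.4 and Cor. 1.5 (p. 812)] [cite: McCallumLMS1991, Cor. 5.6] [cite: Serre1972, §2.4 Prop. 15, §2.8 Prop. 19] [cite: Cremona2006, Table 1 (label 475722bc1)] -/
theorem bsdpJD_475722bc1_3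
    (hJ : JetchevDivisibilityCarrierNe)
    (hMcU : McCallum1991_padicValNat_card_sha_primary_add_le_of_globalDivisibility)
    (hGZK : rank_eq_analyticRank_of_analyticRank_le_one)
    (hKo : ∀ (N : ℕ) [NeZero N] (W : WeierstrassCurve ℚ) (K : Type) [Field K] [NumberField K], kolyvagin N W K)
    (hrec : ∀ (N : ℕ) [NeZero N] (W : WeierstrassCurve ℚ) (K : Type) [Field K] [NumberField K],
      heegnerPointOfConductor_one_galoisConj N W K)
    (hD36 : ∀ (N : ℕ) [NeZero N] (W : WeierstrassCurve ℚ) (K : Type) [Field K] [NumberField K],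
      phi_heegnerTau_mem_singularModuliField N W K)
    (hlev : ∀ {N : ℕ} [NeZero N], IsNewformOf.level_eq_conductorNorm (N := N))
    (W : WeierstrassCurve ℚ) (hW : W = ⟨1, -1, 1, -316895, -68627001⟩)
    {N : ℕ} [NeZero N] {K : Type} [Field K] [NumberField K] (hK : IsImaginaryQuadratic K)
    (hD3 : NumberField.discr K ≠ -3) (hD4 : NumberField.discr K ≠ -4)
    (hH : SatisfiesHeegnerHypothesis N K) {P : (W.baseChange K).toAffine.Point}
    (hP : IsHeegnerPoint N W K P) (hnt : ¬ IsOfFinAddOrder P) (hqN : 2 ∣ N)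
    (hv : padicValNat 3 (AddSubgroup.zmultiples P).index ≤ 3)
    (hr : W.analyticRank ≤ 1) {s : ℚ} (hs : shaAn W = (s : ℂ)) (hvs : padicValRat 3 s = 0) : BSDp W 3 :=
  bsdp_of_jetRowA3F_tam_min 1 (-1) 1 (-316895) (-68627001)
    (Supersingular.isGloballyMinimal_of_krausCriterion₃_factored 1 (-1) 1 (-316895) (-68627001) [(2, 27), (3, 6), (13, 1), (19, 1), (107, 1)] (by decide +kernel)
      (by intro t ht; fin_cases ht <;> norm_num) (by decide +kernel))
    11 7 (by norm_num) (by norm_num) (by decide) (by decide) (by decide) (by decide) (by decide +kernel) (by decide +kernel)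
    (n₁ := 14) (n₂ := 6) (by decide +kernel) (by decide +kernel) (by decide) (by decide) (by decide) (by decide)
    83 (by norm_num) (by decide) (by decide +kernel) (n₉ := 72) (by decide +kernel) (by decide) (by decide)
    2 ⟨2, 1, 1, 0, 0, 0, 0, 27, 0, 0, 27⟩ rfl (by decide +kernel) (c := 27) (by decide +kernel) (w := 3) (by decide +kernel) (by decide)
    hJ hMcU hGZK hKo hrec hD36 hlev W hW hK hD3 hD4 hH hP hnt hqN hv hr hs hvs

/-- **`BSD(E,3)` for `480474c1`** (cell `(480474c1, 3)`, class X4, rank 0; JET grammar key `JETA:480474c1@3`, bucket A at `p = 3`, `E` additive at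
`3` (door `JET.bsdp_of_jetRowA3F_tam_min`, `3`-adic tower by a Frobenius witness mod `9`)); `N = 480474 = 2·3^2·26693`, additive `III` at `3`, `r_an
= 0`, `#E(ℚ)_tors = 2`, `∏c = 36`, `#Ш_an = 1`, Cremona galrep: no code at this prime (`ρ̄_{E,3}` onto); `|Δ| = ∏` over `[(2, 18), (3, 3), (26693,
1)]` (factored Kraus criterion, every disjunct decided). The ONE carrier: carrier `q = 2` (split `I18`, `c_q = 18`, `w = ord_3 c_q = 2`; IN THE
KERNEL by the `TamLocal` certificate `⟨2, 1, 1, 0, 0, 0, 0, 18, 0, 0, 18⟩`); READING binder `hJ` = K1 `JetchevDivisibilityCarrierNe`; displayed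
index line `hv : ord_3 [E(K):ℤP] ≤ 2`. Serre Prop-15 witnesses mod `3`: `(ℓ, #Ẽ(𝔽_ℓ))` = `(5, 4)` (`X² − aX + ℓ` root-free over `𝔽₃`), `(19, 24)`
(`ℓ ≡ 1`, `a ≡ 2 (mod 3)`, `9 ∤ #Ẽ`); `3`-adic tower witness `(ℓ₉, #Ẽ) = (29, 36)` (`ℓ₉ ≡ 2 (mod 9)`, `a_ℓ₉ ≡ 3 (mod 9)`). Kurihara lane note of
record: «additive p, irreducible». State of record (referee A ROUND 983, `scratchA_A_state_after_x4gh_add3_onA2R977_fold.pkl`): class `residue`, 1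
open cell(s), register empty. FLAG `opt-code-2` (Cremona optimality code 2; `ρ̄_{E,3}` onto forbids a `3`-isogeny in the class, so `ord_3` of the
index is class-invariant; the reading stands if the optimal curve's Manin constant is prime to `3`). Other engine-1 fields tried (`D`: `m` (`ord_3
m`)): `-191`: `m = 18` (`ord = 2`); `-215`: `m = 36` (`ord = 2`); `-287`: `m = 36` (`ord = 2`); `-335`: `m = 36` (`ord = 2`); `-551`: `m = 36` (`ord
= 2`); `-599`: `m = 18` (`ord = 2`); `-743`: `m = 18` (`ord = 2`); `-767`: `m = 36` (`ord = 2`); `-791`: `m = 36` (`ord = 2`). THIS UNIT'S DATUM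
(displayed, NOT re-computed here): DEEP FIELD `K = ℚ(√-23)` (`23` = prime): rank-one twist `F = E^D` (`N_F = 254170746`), point `x` on `F` by
ellrank0 (saturated at the primes `< 100`), **`m = [E(K):ℤy_K] = 18`, `ord_3 m = 2`** (`ρ = m²/4`, `L(E,1) = 6.0337994269`, `L'(F,1) =
13.658770436`, `ĥ(x) = 6.6808599954`) — engine 1 j293245 = engine 2 j293855: `m = 18` EQUAL (FAIL:p2_not_div_N, dev ≤ 1.1e-14); twist `E^D`
(j293857): `N = 254170746`, `#tors·∏c·#Ш_an = 2·72·1`, `ord_3 #Ш_an(E^D) = 0`, `ord_3 ∏c(E^D) = 2` (BSD-consistent). CONDITIONAL on every binder;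
per cell; nothing booked by this file.
[cite: Jetchev2008, Thm. 1.4 and Cor. 1.5 (p. 812)] [cite: McCallumLMS1991, Cor. 5.6] [cite: Serre1972, §2.4 Prop. 15, §2.8 Prop. 19] [cite: Cremona2006, Table 1 (label 480474c1)] -/
theorem bsdpJD_480474c1_3
    (hJ : JetchevDivisibilityCarrierNe)
    (hMcU : McCallum1991_padicValNat_card_sha_primary_add_le_of_globalDivisibility)
    (hGZK : rank_eq_analyticRank_of_analyticRank_le_one)
    (hKo : ∀ (N : ℕ) [NeZero N] (W : WeierstrassCurve ℚ) (K : Type) [Field K] [NumberField K], kolyvagin N W K)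
    (hrec : ∀ (N : ℕ) [NeZero N] (W : WeierstrassCurve ℚ) (K : Type) [Field K] [NumberField K],
      heegnerPointOfConductor_one_galoisConj N W K)
    (hD36 : ∀ (N : ℕ) [NeZero N] (W : WeierstrassCurve ℚ) (K : Type) [Field K] [NumberField K],
      phi_heegnerTau_mem_singularModuliField N W K)
    (hlev : ∀ {N : ℕ} [NeZero N], IsNewformOf.level_eq_conductorNorm (N := N))
    (W : WeierstrassCurve ℚ) (hW : W = ⟨1, -1, 1, 1156, 14143⟩)
    {N : ℕ} [NeZero N] {K : Type} [Field K] [NumberField K] (hK : IsImaginaryQuadratic K)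
    (hD3 : NumberField.discr K ≠ -3) (hD4 : NumberField.discr K ≠ -4)
    (hH : SatisfiesHeegnerHypothesis N K) {P : (W.baseChange K).toAffine.Point}
    (hP : IsHeegnerPoint N W K P) (hnt : ¬ IsOfFinAddOrder P) (hqN : 2 ∣ N)
    (hv : padicValNat 3 (AddSubgroup.zmultiples P).index ≤ 2)
    (hr : W.analyticRank ≤ 1) {s : ℚ} (hs : shaAn W = (s : ℂ)) (hvs : padicValRat 3 s = 0) : BSDp W 3 :=
  bsdp_of_jetRowA3F_tam_min 1 (-1) 1 1156 14143
    (Supersingular.isGloballyMinimal_of_krausCriterion₃_factored 1 (-1) 1 1156 14143 [(2, 18), (3, 3), (26693, 1)] (by decide +kernel)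
      (by intro t ht; fin_cases ht <;> norm_num) (by decide +kernel))
    5 19 (by norm_num) (by norm_num) (by decide) (by decide) (by decide) (by decide) (by decide +kernel) (by decide +kernel)
    (n₁ := 4) (n₂ := 24) (by decide +kernel) (by decide +kernel) (by decide) (by decide) (by decide) (by decide)
    29 (by norm_num) (by decide) (by decide +kernel) (n₉ := 36) (by decide +kernel) (by decide) (by decide)
    2 ⟨2, 1, 1, 0, 0, 0, 0, 18, 0, 0, 18⟩ rfl (by decide +kernel) (c := 18) (by decide +kernel) (w := 2) (by decide +kernel) (by decide)
    hJ hMcU hGZK hKo hrec hD36 hlev W hW hK hD3 hD4 hH hP hnt hqN hv hr hs hvs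

/-- **`BSD(E,3)` for `483318o1`** (cell `(483318o1, 3)`, class X4, rank 0; JET grammar key `JETA:483318o1@3`, bucket A at `p = 3`, `E` additive at
`3` (door `JET.bsdp_of_jetRowA3F_tam_min`, `3`-adic tower by a Frobenius witness mod `9`)); `N = 483318 = 2·3^2·11·2441`, additive `III*` at `3`,
`r_an = 0`, `#E(ℚ)_tors = 1`, `∏c = 72`, `#Ш_an = 1`, Cremona galrep: no code at this prime (`ρ̄_{E,3}` onto); `|Δ| = ∏` over `[(2, 18), (3, 9),
(11, 2), (2441, 1)]` (factored Kraus criterion, every disjunct decided). The ONE carrier: carrier `q = 2` (split `I18`, `c_q = 18`, `w = ord_3 c_q =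
2`; IN THE KERNEL by the `TamLocal` certificate `⟨2, 1, 1, 0, 0, 0, 0, 18, 0, 0, 18⟩`); READING binder `hJ` = K1 `JetchevDivisibilityCarrierNe`;
displayed index line `hv : ord_3 [E(K):ℤP] ≤ 2`. Serre Prop-15 witnesses mod `3`: `(ℓ, #Ẽ(𝔽_ℓ))` = `(5, 2)` (`X² − aX + ℓ` root-free over `𝔽₃`),
`(19, 15)` (`ℓ ≡ 1`, `a ≡ 2 (mod 3)`, `9 ∤ #Ẽ`); `3`-adic tower witness `(ℓ₉, #Ẽ) = (23, 30)` (`ℓ₉ ≡ 5 (mod 9)`, `a_ℓ₉ ≡ 3 (mod 9)`). Kurihara lane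
note of record: «additive p, irreducible». State of record (referee A ROUND 983, `scratchA_A_state_after_x4gh_add3_onA2R977_fold.pkl`): class
`residue`, 1 open cell(s), register empty. Other engine-1 fields tried (`D`: `m` (`ord_3 m`)): `-239`: `m = 144` (`ord = 2`); `-263`: `m = 144`
(`ord = 2`); `-479`: `m = 144` (`ord = 2`); `-503`: `m = 144` (`ord = 2`); `-527`: `m = 144` (`ord = 2`); `-623`: `m = 144` (`ord = 2`); `-743`: `m
= 144` (`ord = 2`); `-767`: `m = 144` (`ord = 2`); `-791`: `m = 144` (`ord = 2`); `-887`: `m = 432` (`ord = 3`); `-1031`: `m = 144` (`ord = 2`);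
`-1055`: `m = 144` (`ord = 2`); `-1151`: `m = 432` (`ord = 3`); `-1223`: `m = 144` (`ord = 2`). THIS UNIT'S DATUM (displayed, NOT re-computed here):
DEEP FIELD `K = ℚ(√-95)` (`95` = 5·19): rank-one twist `F = E^D` (`N_F = 4361944950`), point `x` on `F` by ellrank0 (saturated at the primes `<
100`), **`m = [E(K):ℤy_K] = 144`, `ord_3 m = 2`** (`ρ = m²/4`, `L(E,1) = 13.427491487`, `L'(F,1) = 27.762862873`, `ĥ(x) = 4.3581485552`) — engine 1
j293243 = engine 2 j293855: `m = 144` EQUAL (FAIL:p2_not_div_N, dev ≤ 9.8e-15); twist `E^D` (j293857): `N = 4361944950`, `#tors·∏c·#Ш_an = 1·144·1`,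
`ord_3 #Ш_an(E^D) = 0`, `ord_3 ∏c(E^D) = 2` (BSD-consistent). CONDITIONAL on every binder; per cell; nothing booked by this file.
[cite: Jetchev2008, Thm. 1.4 and Cor. 1.5 (p. 812)] [cite: McCallumLMS1991, Cor. 5.6] [cite: Serre1972, §2.4 Prop. 15, §2.8 Prop. 19] [cite: Cremona2006, Table 1 (label 483318o1)] -/
theorem bsdpJD_483318o1_3
    (hJ : JetchevDivisibilityCarrierNe)
    (hMcU : McCallum1991_padicValNat_card_sha_primary_add_le_of_globalDivisibility)
    (hGZK : rank_eq_analyticRank_of_analyticRank_le_one)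
    (hKo : ∀ (N : ℕ) [NeZero N] (W : WeierstrassCurve ℚ) (K : Type) [Field K] [NumberField K], kolyvagin N W K)
    (hrec : ∀ (N : ℕ) [NeZero N] (W : WeierstrassCurve ℚ) (K : Type) [Field K] [NumberField K],
      heegnerPointOfConductor_one_galoisConj N W K)
    (hD36 : ∀ (N : ℕ) [NeZero N] (W : WeierstrassCurve ℚ) (K : Type) [Field K] [NumberField K],
      phi_heegnerTau_mem_singularModuliField N W K)
    (hlev : ∀ {N : ℕ} [NeZero N], IsNewformOf.level_eq_conductorNorm (N := N))
    (W : WeierstrassCurve ℚ) (hW : W = ⟨1, -1, 1, -22358, -2271131⟩)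
    {N : ℕ} [NeZero N] {K : Type} [Field K] [NumberField K] (hK : IsImaginaryQuadratic K)
    (hD3 : NumberField.discr K ≠ -3) (hD4 : NumberField.discr K ≠ -4)
    (hH : SatisfiesHeegnerHypothesis N K) {P : (W.baseChange K).toAffine.Point}
    (hP : IsHeegnerPoint N W K P) (hnt : ¬ IsOfFinAddOrder P) (hqN : 2 ∣ N)
    (hv : padicValNat 3 (AddSubgroup.zmultiples P).index ≤ 2)
    (hr : W.analyticRank ≤ 1) {s : ℚ} (hs : shaAn W = (s : ℂ)) (hvs : padicValRat 3 s = 0) : BSDp W 3 :=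
  bsdp_of_jetRowA3F_tam_min 1 (-1) 1 (-22358) (-2271131)
    (Supersingular.isGloballyMinimal_of_krausCriterion₃_factored 1 (-1) 1 (-22358) (-2271131) [(2, 18), (3, 9), (11, 2), (2441, 1)] (by decide +kernel)
      (by intro t ht; fin_cases ht <;> norm_num) (by decide +kernel))
    5 19 (by norm_num) (by norm_num) (by decide) (by decide) (by decide) (by decide) (by decide +kernel) (by decide +kernel)
    (n₁ := 2) (n₂ := 15) (by decide +kernel) (by decide +kernel) (by decide) (by decide) (by decide) (by decide)
    23 (by norm_num) (by decide) (by decide +kernel) (n₉ := 30) (by decide +kernel) (by decide) (by decide)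
    2 ⟨2, 1, 1, 0, 0, 0, 0, 18, 0, 0, 18⟩ rfl (by decide +kernel) (c := 18) (by decide +kernel) (w := 2) (by decide +kernel) (by decide)
    hJ hMcU hGZK hKo hrec hD36 hlev W hW hK hD3 hD4 hH hP hnt hqN hv hr hs hvs

/-- **`BSD(E,3)` for `483426l1`** (cell `(483426l1, 3)`, class X4, rank 0; JET grammar key `JETA:483426l1@3`, bucket A at `p = 3`, `E` additive at
`3` (door `JET.bsdp_of_jetRowA3F_tam_min`, `3`-adic tower by a Frobenius witness mod `9`)); `N = 483426 = 2·3^2·107·251`, additive `I0*` at `3`,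
`r_an = 0`, `#E(ℚ)_tors = 1`, `∏c = 36`, `#Ш_an = 1`, Cremona galrep: no code at this prime (`ρ̄_{E,3}` onto); `|Δ| = ∏` over `[(2, 18), (3, 6),
(107, 1), (251, 1)]` (factored Kraus criterion, every disjunct decided). The ONE carrier: carrier `q = 2` (split `I18`, `c_q = 18`, `w = ord_3 c_q =
2`; IN THE KERNEL by the `TamLocal` certificate `⟨2, 1, 1, 0, 0, 0, 0, 18, 0, 0, 18⟩`); READING binder `hJ` = K1 `JetchevDivisibilityCarrierNe`;
displayed index line `hv : ord_3 [E(K):ℤP] ≤ 2`. Serre Prop-15 witnesses mod `3`: `(ℓ, #Ẽ(𝔽_ℓ))` = `(11, 13)` (`X² − aX + ℓ` root-free over `𝔽₃`),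
`(79, 84)` (`ℓ ≡ 1`, `a ≡ 2 (mod 3)`, `9 ∤ #Ẽ`); `3`-adic tower witness `(ℓ₉, #Ẽ) = (41, 39)` (`ℓ₉ ≡ 5 (mod 9)`, `a_ℓ₉ ≡ 3 (mod 9)`). Kurihara lane
note of record: «additive p, irreducible». State of record (referee A ROUND 983, `scratchA_A_state_after_x4gh_add3_onA2R977_fold.pkl`): class
`residue`, 1 open cell(s), register empty. Other engine-1 fields tried (`D`: `m` (`ord_3 m`)): `-95`: `m = 72` (`ord = 2`); `-167`: `m = 72` (`ord =
2`); `-191`: `m = 72` (`ord = 2`); `-479`: `m = 72` (`ord = 2`); `-647`: `m = 216` (`ord = 3`); `-767`: `m = 144` (`ord = 2`); `-815`: `m = 144`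
(`ord = 2`); `-887`: `m = 72` (`ord = 2`); `-911`: `m = 72` (`ord = 2`); `-983`: `m = 72` (`ord = 2`); `-1415`: `m = 144` (`ord = 2`); `-1943`: `m =
72` (`ord = 2`); `-1991`: `m = 72` (`ord = 2`). THIS UNIT'S DATUM (displayed, NOT re-computed here): DEEP FIELD `K = ℚ(√-71)` (`71` = prime):
rank-one twist `F = E^D` (`N_F = 2436950466`), point `x` on `F` by ellrank0 (saturated at the primes `< 100`), **`m = [E(K):ℤy_K] = 72`, `ord_3 m =
2`** (`ρ = m²/4`, `L(E,1) = 9.7652889281`, `L'(F,1) = 15.842916423`, `ĥ(x) = 2.5414392549`) — engine 1 j293245 = engine 2 j295408: `m = 72` EQUAL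
(FAIL:p2_not_div_N, dev ≤ 3.7e-15); twist `E^D` (j293857): `N = 2436950466`, `#tors·∏c·#Ш_an = 1·72·1`, `ord_3 #Ш_an(E^D) = 0`, `ord_3 ∏c(E^D) = 2`
(BSD-consistent). CONDITIONAL on every binder; per cell; nothing booked by this file.
[cite: Jetchev2008, Thm. 1.4 and Cor. 1.5 (p. 812)] [cite: McCallumLMS1991, Cor. 5.6] [cite: Serre1972, §2.4 Prop. 15, §2.8 Prop. 19] [cite: Cremona2006, Table 1 (label 483426l1)] -/
theorem bsdpJD_483426l1_3
    (hJ : JetchevDivisibilityCarrierNe)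
    (hMcU : McCallum1991_padicValNat_card_sha_primary_add_le_of_globalDivisibility)
    (hGZK : rank_eq_analyticRank_of_analyticRank_le_one)
    (hKo : ∀ (N : ℕ) [NeZero N] (W : WeierstrassCurve ℚ) (K : Type) [Field K] [NumberField K], kolyvagin N W K)
    (hrec : ∀ (N : ℕ) [NeZero N] (W : WeierstrassCurve ℚ) (K : Type) [Field K] [NumberField K],
      heegnerPointOfConductor_one_galoisConj N W K)
    (hD36 : ∀ (N : ℕ) [NeZero N] (W : WeierstrassCurve ℚ) (K : Type) [Field K] [NumberField K],
      phi_heegnerTau_mem_singularModuliField N W K)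
    (hlev : ∀ {N : ℕ} [NeZero N], IsNewformOf.level_eq_conductorNorm (N := N))
    (W : WeierstrassCurve ℚ) (hW : W = ⟨1, -1, 1, -5690, -196487⟩)
    {N : ℕ} [NeZero N] {K : Type} [Field K] [NumberField K] (hK : IsImaginaryQuadratic K)
    (hD3 : NumberField.discr K ≠ -3) (hD4 : NumberField.discr K ≠ -4)
    (hH : SatisfiesHeegnerHypothesis N K) {P : (W.baseChange K).toAffine.Point}
    (hP : IsHeegnerPoint N W K P) (hnt : ¬ IsOfFinAddOrder P) (hqN : 2 ∣ N)
    (hv : padicValNat 3 (AddSubgroup.zmultiples P).index ≤ 2)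
    (hr : W.analyticRank ≤ 1) {s : ℚ} (hs : shaAn W = (s : ℂ)) (hvs : padicValRat 3 s = 0) : BSDp W 3 :=
  bsdp_of_jetRowA3F_tam_min 1 (-1) 1 (-5690) (-196487)
    (Supersingular.isGloballyMinimal_of_krausCriterion₃_factored 1 (-1) 1 (-5690) (-196487) [(2, 18), (3, 6), (107, 1), (251, 1)] (by decide +kernel)
      (by intro t ht; fin_cases ht <;> norm_num) (by decide +kernel))
    11 79 (by norm_num) (by norm_num) (by decide) (by decide) (by decide) (by decide) (by decide +kernel) (by decide +kernel)
    (n₁ := 13) (n₂ := 84) (by decide +kernel) (by decide +kernel) (by decide) (by decide) (by decide) (by decide)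
    41 (by norm_num) (by decide) (by decide +kernel) (n₉ := 39) (by decide +kernel) (by decide) (by decide)
    2 ⟨2, 1, 1, 0, 0, 0, 0, 18, 0, 0, 18⟩ rfl (by decide +kernel) (c := 18) (by decide +kernel) (w := 2) (by decide +kernel) (by decide)
    hJ hMcU hGZK hKo hrec hD36 hlev W hW hK hD3 hD4 hH hP hnt hqN hv hr hs hvs

/-- **`BSD(E,3)` for `487026z1`** (cell `(487026z1, 3)`, class X4, rank 0; JET grammar key `JETA:487026z1@3`, bucket A at `p = 3`, `E` additive at
`3` (door `JET.bsdp_of_jetRowA3F_tam_min`, `3`-adic tower by a Frobenius witness mod `9`)); `N = 487026 = 2·3^3·29·311`, additive `II*` at `3`,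
`r_an = 0`, `#E(ℚ)_tors = 1`, `∏c = 9`, `#Ш_an = 1`, Cremona galrep: no code at this prime (`ρ̄_{E,3}` onto); `|Δ| = ∏` over `[(2, 9), (3, 11), (29,
1), (311, 1)]` (factored Kraus criterion, every disjunct decided). The ONE carrier: carrier `q = 2` (split `I9`, `c_q = 9`, `w = ord_3 c_q = 2`; IN
THE KERNEL by the `TamLocal` certificate `⟨2, 1, 1, 0, 0, 0, 0, 9, 0, 0, 9⟩`); READING binder `hJ` = K1 `JetchevDivisibilityCarrierNe`; displayed
index line `hv : ord_3 [E(K):ℤP] ≤ 2`. Serre Prop-15 witnesses mod `3`: `(ℓ, #Ẽ(𝔽_ℓ))` = `(7, 5)` (`X² − aX + ℓ` root-free over `𝔽₃`), `(31, 39)`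
(`ℓ ≡ 1`, `a ≡ 2 (mod 3)`, `9 ∤ #Ẽ`); `3`-adic tower witness `(ℓ₉, #Ẽ) = (5, 3)` (`ℓ₉ ≡ 5 (mod 9)`, `a_ℓ₉ ≡ 3 (mod 9)`). Kurihara lane note of
record: «additive p, irreducible». State of record (referee A ROUND 983, `scratchA_A_state_after_x4gh_add3_onA2R977_fold.pkl`): class `residue`, 1
open cell(s), register empty. Other engine-1 fields tried (`D`: `m` (`ord_3 m`)): `-71`: `m = 36` (`ord = 2`); `-767`: `m = 36` (`ord = 2`);
`-1103`: `m = 36` (`ord = 2`); `-1223`: `m = 36` (`ord = 2`); `-1343`: `m = 36` (`ord = 2`); `-1727`: `m = 72` (`ord = 2`). THIS UNIT'S DATUM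
(displayed, NOT re-computed here): DEEP FIELD `K = ℚ(√-23)` (`23` = prime): rank-one twist `F = E^D` (`N_F = 257636754`), point `x` on `F` by
ellrank0 (saturated at the primes `< 100`), **`m = [E(K):ℤy_K] = 18`, `ord_3 m = 2`** (`ρ = m²/4`, `L(E,1) = 8.0144748726`, `L'(F,1) =
7.2490998595`, `ĥ(x) = 9.3900306227`) — engine 1 j293243 = engine 2 j295408: `m = 18` EQUAL (FAIL:p2_not_div_N, dev ≤ 1.8e-15); twist `E^D`
(j293857): `N = 257636754`, `#tors·∏c·#Ш_an = 1·9·1`, `ord_3 #Ш_an(E^D) = 0`, `ord_3 ∏c(E^D) = 2` (BSD-consistent). CONDITIONAL on every binder; per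
cell; nothing booked by this file.
[cite: Jetchev2008, Thm. 1.4 and Cor. 1.5 (p. 812)] [cite: McCallumLMS1991, Cor. 5.6] [cite: Serre1972, §2.4 Prop. 15, §2.8 Prop. 19] [cite: Cremona2006, Table 1 (label 487026z1)] -/
theorem bsdpJD_487026z1_3
    (hJ : JetchevDivisibilityCarrierNe)
    (hMcU : McCallum1991_padicValNat_card_sha_primary_add_le_of_globalDivisibility)
    (hGZK : rank_eq_analyticRank_of_analyticRank_le_one)
    (hKo : ∀ (N : ℕ) [NeZero N] (W : WeierstrassCurve ℚ) (K : Type) [Field K] [NumberField K], kolyvagin N W K)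
    (hrec : ∀ (N : ℕ) [NeZero N] (W : WeierstrassCurve ℚ) (K : Type) [Field K] [NumberField K],
      heegnerPointOfConductor_one_galoisConj N W K)
    (hD36 : ∀ (N : ℕ) [NeZero N] (W : WeierstrassCurve ℚ) (K : Type) [Field K] [NumberField K],
      phi_heegnerTau_mem_singularModuliField N W K)
    (hlev : ∀ {N : ℕ} [NeZero N], IsNewformOf.level_eq_conductorNorm (N := N))
    (W : WeierstrassCurve ℚ) (hW : W = ⟨1, -1, 1, -18146, 944353⟩)
    {N : ℕ} [NeZero N] {K : Type} [Field K] [NumberField K] (hK : IsImaginaryQuadratic K)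
    (hD3 : NumberField.discr K ≠ -3) (hD4 : NumberField.discr K ≠ -4)
    (hH : SatisfiesHeegnerHypothesis N K) {P : (W.baseChange K).toAffine.Point}
    (hP : IsHeegnerPoint N W K P) (hnt : ¬ IsOfFinAddOrder P) (hqN : 2 ∣ N)
    (hv : padicValNat 3 (AddSubgroup.zmultiples P).index ≤ 2)
    (hr : W.analyticRank ≤ 1) {s : ℚ} (hs : shaAn W = (s : ℂ)) (hvs : padicValRat 3 s = 0) : BSDp W 3 :=
  bsdp_of_jetRowA3F_tam_min 1 (-1) 1 (-18146) 944353
    (Supersingular.isGloballyMinimal_of_krausCriterion₃_factored 1 (-1) 1 (-18146) 944353 [(2, 9), (3, 11), (29, 1), (311, 1)] (by decide +kernel)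
      (by intro t ht; fin_cases ht <;> norm_num) (by decide +kernel))
    7 31 (by norm_num) (by norm_num) (by decide) (by decide) (by decide) (by decide) (by decide +kernel) (by decide +kernel)
    (n₁ := 5) (n₂ := 39) (by decide +kernel) (by decide +kernel) (by decide) (by decide) (by decide) (by decide)
    5 (by norm_num) (by decide) (by decide +kernel) (n₉ := 3) (by decide +kernel) (by decide) (by decide)
    2 ⟨2, 1, 1, 0, 0, 0, 0, 9, 0, 0, 9⟩ rfl (by decide +kernel) (c := 9) (by decide +kernel) (w := 2) (by decide +kernel) (by decide)
    hJ hMcU hGZK hKo hrec hD36 hlev W hW hK hD3 hD4 hH hP hnt hqN hv hr hs hvs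

/-- **`BSD(E,3)` for `488070dt1`** (cell `(488070dt1, 3)`, class X4, rank 0; JET grammar key `JETA:488070dt1@3`, bucket A at `p = 3`, `E` additive
at `3` (door `JET.bsdp_of_jetRowA3F_tam_min`, `3`-adic tower by a Frobenius witness mod `9`)); `N = 488070 = 2·3^2·5·11·17·29`, additive `III*` at
`3`, `r_an = 0`, `#E(ℚ)_tors = 2`, `∏c = 1008`, `#Ш_an = 1`, Cremona galrep: no code at this prime (`ρ̄_{E,3}` onto); `|Δ| = ∏` over `[(2, 18), (3,
9), (5, 7), (11, 8), (17, 1), (29, 2)]` (factored Kraus criterion, every disjunct decided). The ONE carrier: carrier `q = 2` (split `I18`, `c_q =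
18`, `w = ord_3 c_q = 2`; IN THE KERNEL by the `TamLocal` certificate `⟨2, 1, 1, 0, 0, 0, 0, 18, 0, 0, 18⟩`); READING binder `hJ` = K1
`JetchevDivisibilityCarrierNe`; displayed index line `hv : ord_3 [E(K):ℤP] ≤ 2`. Serre Prop-15 witnesses mod `3`: `(ℓ, #Ẽ(𝔽_ℓ))` = `(13, 14)` (`X² −
aX + ℓ` root-free over `𝔽₃`), `(7, 12)` (`ℓ ≡ 1`, `a ≡ 2 (mod 3)`, `9 ∤ #Ẽ`); `3`-adic tower witness `(ℓ₉, #Ẽ) = (59, 54)` (`ℓ₉ ≡ 5 (mod 9)`, `a_ℓ₉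
≡ 6 (mod 9)`). Kurihara lane note of record: «additive p, irreducible». State of record (referee A ROUND 983,
`scratchA_A_state_after_x4gh_add3_onA2R977_fold.pkl`): class `residue`, 1 open cell(s), register empty. FLAG `opt-code-2` (Cremona optimality code
2; `ρ̄_{E,3}` onto forbids a `3`-isogeny in the class, so `ord_3` of the index is class-invariant; the reading stands if the optimal curve's Manin
constant is prime to `3`). Other engine-1 fields tried (`D`: `m` (`ord_3 m`)): `-1271`: `m = 1008` (`ord = 2`); `-3911`: `m = 504` (`ord = 2`). THIS
UNIT'S DATUM (displayed, NOT re-computed here): DEEP FIELD `K = ℚ(√-239)` (`239` = prime): rank-one twist `F = E^D` (`N_F = 27879046470`), point `x`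
on `F` by ellrank0 (saturated at the primes `< 100`), **`m = [E(K):ℤy_K] = 504`, `ord_3 m = 2`** (`ρ = m²/4`, `L(E,1) = 2.8602394260`, `L'(F,1) =
45.602235213`, `ĥ(x) = 28.859629183`) — engine 1 j293245 = engine 2 j295408: `m = 504` EQUAL (FAIL:p2_not_div_N, dev ≤ 2.0e-15); twist `E^D`
(j293857): `N = 27879046470`, `#tors·∏c·#Ш_an = 2·2016·1`, `ord_3 #Ш_an(E^D) = 0`, `ord_3 ∏c(E^D) = 2` (BSD-consistent). CONDITIONAL on every
binder; per cell; nothing booked by this file.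
[cite: Jetchev2008, Thm. 1.4 and Cor. 1.5 (p. 812)] [cite: McCallumLMS1991, Cor. 5.6] [cite: Serre1972, §2.4 Prop. 15, §2.8 Prop. 19] [cite: Cremona2006, Table 1 (label 488070dt1)] -/
theorem bsdpJD_488070dt1_3
    (hJ : JetchevDivisibilityCarrierNe)
    (hMcU : McCallum1991_padicValNat_card_sha_primary_add_le_of_globalDivisibility)
    (hGZK : rank_eq_analyticRank_of_analyticRank_le_one)
    (hKo : ∀ (N : ℕ) [NeZero N] (W : WeierstrassCurve ℚ) (K : Type) [Field K] [NumberField K], kolyvagin N W K)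
    (hrec : ∀ (N : ℕ) [NeZero N] (W : WeierstrassCurve ℚ) (K : Type) [Field K] [NumberField K],
      heegnerPointOfConductor_one_galoisConj N W K)
    (hD36 : ∀ (N : ℕ) [NeZero N] (W : WeierstrassCurve ℚ) (K : Type) [Field K] [NumberField K],
      phi_heegnerTau_mem_singularModuliField N W K)
    (hlev : ∀ {N : ℕ} [NeZero N], IsNewformOf.level_eq_conductorNorm (N := N))
    (W : WeierstrassCurve ℚ) (hW : W = ⟨1, -1, 1, -1955759042, -33332996860991⟩)
    {N : ℕ} [NeZero N] {K : Type} [Field K] [NumberField K] (hK : IsImaginaryQuadratic K)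
    (hD3 : NumberField.discr K ≠ -3) (hD4 : NumberField.discr K ≠ -4)
    (hH : SatisfiesHeegnerHypothesis N K) {P : (W.baseChange K).toAffine.Point}
    (hP : IsHeegnerPoint N W K P) (hnt : ¬ IsOfFinAddOrder P) (hqN : 2 ∣ N)
    (hv : padicValNat 3 (AddSubgroup.zmultiples P).index ≤ 2)
    (hr : W.analyticRank ≤ 1) {s : ℚ} (hs : shaAn W = (s : ℂ)) (hvs : padicValRat 3 s = 0) : BSDp W 3 :=
  bsdp_of_jetRowA3F_tam_min 1 (-1) 1 (-1955759042) (-33332996860991)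
    (Supersingular.isGloballyMinimal_of_krausCriterion₃_factored 1 (-1) 1 (-1955759042) (-33332996860991) [(2, 18), (3, 9), (5, 7), (11, 8), (17, 1), (29, 2)] (by decide +kernel)
      (by intro t ht; fin_cases ht <;> norm_num) (by decide +kernel))
    13 7 (by norm_num) (by norm_num) (by decide) (by decide) (by decide) (by decide) (by decide +kernel) (by decide +kernel)
    (n₁ := 14) (n₂ := 12) (by decide +kernel) (by decide +kernel) (by decide) (by decide) (by decide) (by decide)
    59 (by norm_num) (by decide) (by decide +kernel) (n₉ := 54) (by decide +kernel) (by decide) (by decide)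
    2 ⟨2, 1, 1, 0, 0, 0, 0, 18, 0, 0, 18⟩ rfl (by decide +kernel) (c := 18) (by decide +kernel) (w := 2) (by decide +kernel) (by decide)
    hJ hMcU hGZK hKo hrec hD36 hlev W hW hK hD3 hD4 hH hP hnt hqN hv hr hs hvs

end Summit.BirchSwinnertonDyer.Rank1Residual.X4

end
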